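import Literature.MathematicalPhysics.QuantumFieldTheory.Balaban1983to89.T4AxialGaugeSmallField
import Literature.MathematicalPhysics.QuantumFieldTheory.Balaban1983to89.B8Thm2SetupTorus
import HarnessLib

/-!
# S2β · (REG) BRIDGE — «THE ROWS' GAUGE SANDWICH IS `conjR` BY THE COMB TRANSPORT OF THE UNITS READING»: the torus axial gauge `axialGauge U lo hi`
# of `T4AxialGaugeSmallField` (the c₁ rows' `h·X·h⋆`) docked onto the `ℤᵈ`∕`conjR`∕`axialFn` form of px13 g29's (R-3) letter, level-generic

Cell `ym3-torus` (rung R3 = continuum `SU(2)` YM₃ on T³ at fixed lattice data — NOT d = 4, NOT infinite volume, NOT a mass gap, NOT Clay).  Width seat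
`ym3-torus-px16` (gen 24); crux `stmt-QuantumFields-20520`, LINE g18-1 S2β (registry `Lines/semiclassical_s2beta.lean` untouched); planner item (P8)∕(REG)
«covariant-gradient regularity of the relative field on the fibre» (architect px17 g23, desk RULINGS №124∕№124-A): px13 g29's (R-3) letter
`…CovariantOscillationOfThm2` states the covariant oscillation of the [Balaban1985RegularSpaces] Thm-2 representative along lattice words in the `ℤᵈ` vocabulary
`conjR (axialFn V♯ lo x) (F x)` (`V♯ = B10Eq27TorusAxialLog.pull (unitsField (toUField U)) 0`), while the c₁ rows (`rows_K5_cov_osc`'s `hOSC`) sandwich the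
chart field by the TORUS axial gauge `h = axialGauge U lo hi (castSite x)` of `T4AxialGaugeSmallField`: `h·X·h⋆`.  BRIDGE REQUEST px13 g29 (2026-09-01T00:49Z), both
end texts fixed there.  THIS FILE (def-free):
* `transl_zero_eq_castSite`, `pull_eq_pull_zero` — the two pullbacks agree (`T4AxialGaugeSmallField.pull U = B10Eq27TorusAxialLog.pull U 0`);
* `val_axialFn_pull_unitsField_toUField` — the unit `axialFn (B10….pull (unitsField (toUField U)) 0) lo x` has matrix `↑(axialGauge U lo hi (castSite x))` on a
  non-wrapping box, and its inverse has matrix `star` of it;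
* ★ (B1) `coe_axialGauge_mul_mul_star` — `↑h · Y · star ↑h = conjR (axialFn V♯ lo x) Y`;
* (B2) `cfgPull_toUField_apply` — `cfgPull P (toUField U) z μ = unitsField (toUField U) ⟨castSite z, μ⟩`;
* (B3) `norm_sandwich_sub_sandwich_eq` — the rows' two-point `hOSC` left side IS the letter's `‖conjR (axialFn V♯ lo x) (F x) − conjR (axialFn V♯ lo x′) (F x′)‖`.
`--kind proof --supports stmt-QuantumFields-20520 --as helper`, count-neutral, DEFINITION-FREE (0 `def`, 0 `instance`, 0 `sorry`; default heartbeats).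

HONEST.  Dictionary bookkeeping between two landed vocabularies ([Balaban1985Averaging] (9) transports); nothing of Bałaban's analysis is asserted or proved;
`B8Thm2AtT3Members` is UNPROVED at `L = 3`; (REG), «GAUGE-REP», GAP♯∘ (`stub_uniformFibreGapOrbit`, 0∕5), the five REGISTERED stubs, S2β, crux 20520, 19936,
19200, `YM3TorusSU2` are NOT proved; rung R3 = SU(2) YM₃ on T³ — NOT d = 4, NOT infinite volume, NOT a mass gap, NOT Clay; the Yang–Mills mass gap is NOT proved.

References: [Balaban1985Averaging] T. Bałaban, CMP **98** (1985) 17–51, (8)–(9) pp.18–19, (19) p.21; [Balaban1985RegularSpaces] CMP **99** (1985) 75–102, (1.1) p.76,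
(1.36) p.82.
-/

set_option autoImplicit false

noncomputable section

namespace Summit.QuantumFields.YangMills.Theorems.FluctuationComparisonRegPrIntLS2BetaCovariantOscillationTorusComb

open scoped Matrix.Norms.L2Operator
open Literature.MathematicalPhysics.QuantumFieldTheory.Balaban1983to89
open Literature.MathematicalPhysics.QuantumFieldTheory.Balaban1983to89.T4Continuum
open B7Prop1Explicit (hol axialFn treeWord)
open B7Eq78Linearization (conjR conjR_apply)
open B10Eq27TorusAxialLog (transl unitsField toUField suIncl holT hol_pull val_holT_unitsField holT_toUField)
open T4AxialGaugeSmallField (castSite axialGauge axialGauge_castSite)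

variable {P : Params} {j : ℕ}

/-! ## §0 The two pullbacks agree -/

/-- `transl 0 z = castSite z`: translating the origin by `z ∈ ℤᵈ` is the cast of `z`. [cite: Balaban1985Averaging, (9) p.18] -/
theorem transl_zero_eq_castSite (z : Fin P.d → ℤ) : transl (0 : Site P j) z = (castSite z : Site P j) := by
  funext ν
  show (0 : Site P j) ν + ((z ν : ℤ) : ZMod (P.sitesPerDir j)) = ((z ν : ℤ) : ZMod (P.sitesPerDir j))
  have h0 : (0 : Site P j) ν = 0 := rfl
  rw [h0, zero_add]

/-- `T4AxialGaugeSmallField.pull U = B10Eq27TorusAxialLog.pull U 0` (the box pullback is the periodic pullback based at the origin).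
[cite: Balaban1985Averaging, (9) p.18] -/
theorem pull_eq_pull_zero {G : Type*} (U : GaugeField P j G) : T4AxialGaugeSmallField.pull U = B10Eq27TorusAxialLog.pull U 0 := by
  funext z μ
  rw [T4AxialGaugeSmallField.pull_apply, B10Eq27TorusAxialLog.pull_apply, transl_zero_eq_castSite]

/-! ## §1 The comb transport of the units reading vs the torus axial gauge -/

variable {N : ℕ}

/-- The unit `axialFn ((unitsField (toUField U))♯₀) lo x` has matrix `↑(axialFn (pull U) lo x)` — the `SU(N)` comb transport included in `M_N(ℂ)`.
[cite: Balaban1985Averaging, (9) p.18, (19) p.21] -/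
theorem val_axialFn_pull_unitsField_toUField (U : GaugeField P j (Matrix.specialUnitaryGroup (Fin N) ℂ)) (lo x : Fin P.d → ℤ) :
    ((axialFn (B10Eq27TorusAxialLog.pull (unitsField (toUField U)) 0) lo x : (Matrix (Fin N) (Fin N) ℂ)ˣ) : Matrix (Fin N) (Fin N) ℂ) =
      ((axialFn (T4AxialGaugeSmallField.pull U) lo x : Matrix.specialUnitaryGroup (Fin N) ℂ) : Matrix (Fin N) (Fin N) ℂ) := by
  rw [axialFn, axialFn, hol_pull, val_holT_unitsField, holT_toUField, pull_eq_pull_zero, hol_pull]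
  rfl

/-- … and its inverse has matrix `star` of that (unitarity). [cite: Balaban1985Averaging, (9) p.18, (19) p.21] -/
theorem val_inv_axialFn_pull_unitsField_toUField (U : GaugeField P j (Matrix.specialUnitaryGroup (Fin N) ℂ)) (lo x : Fin P.d → ℤ) :
    (((axialFn (B10Eq27TorusAxialLog.pull (unitsField (toUField U)) 0) lo x)⁻¹ : (Matrix (Fin N) (Fin N) ℂ)ˣ) : Matrix (Fin N) (Fin N) ℂ) =
      star ((axialFn (T4AxialGaugeSmallField.pull U) lo x : Matrix.specialUnitaryGroup (Fin N) ℂ) : Matrix (Fin N) (Fin N) ℂ) := by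
  set u : (Matrix (Fin N) (Fin N) ℂ)ˣ := axialFn (B10Eq27TorusAxialLog.pull (unitsField (toUField U)) 0) lo x with hu
  set g : Matrix.specialUnitaryGroup (Fin N) ℂ := axialFn (T4AxialGaugeSmallField.pull U) lo x with hg
  have hval : (u : Matrix (Fin N) (Fin N) ℂ) = (g : Matrix (Fin N) (Fin N) ℂ) := by
    rw [hu, hg]; exact val_axialFn_pull_unitsField_toUField U lo x
  have hunit : (g : Matrix (Fin N) (Fin N) ℂ) * star (g : Matrix (Fin N) (Fin N) ℂ) = 1 :=
    Matrix.mem_unitaryGroup_iff.mp g.prop.1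
  -- `↑u⁻¹` is the two-sided inverse of `↑u = ↑g`, and so is `star ↑g`
  have h1 : (u : Matrix (Fin N) (Fin N) ℂ) * ((u⁻¹ : (Matrix (Fin N) (Fin N) ℂ)ˣ) : Matrix (Fin N) (Fin N) ℂ) = 1 := Units.mul_inv u
  rw [hval] at h1
  calc ((u⁻¹ : (Matrix (Fin N) (Fin N) ℂ)ˣ) : Matrix (Fin N) (Fin N) ℂ)
      = (star (g : Matrix (Fin N) (Fin N) ℂ) * (g : Matrix (Fin N) (Fin N) ℂ)) * ((u⁻¹ : (Matrix (Fin N) (Fin N) ℂ)ˣ) : Matrix (Fin N) (Fin N) ℂ) := by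
          rw [Matrix.mem_unitaryGroup_iff'.mp g.prop.1, one_mul]
    _ = star (g : Matrix (Fin N) (Fin N) ℂ) := by rw [mul_assoc, h1, mul_one]

/-- ★ (B1) **THE ROWS' GAUGE SANDWICH IS `conjR` BY THE COMB TRANSPORT OF THE UNITS READING**: on a non-wrapping box `[lo, hi]` and `x` in it,
`↑(axialGauge U lo hi (castSite x)) · Y · star ↑(axialGauge U lo hi (castSite x)) = conjR (axialFn ((unitsField (toUField U))♯₀) lo x) Y`.
[cite: Balaban1985Averaging, (8)-(9) pp.18-19, (19) p.21] -/
theorem coe_axialGauge_mul_mul_star [NeZero N] (U : GaugeField P j (Matrix.specialUnitaryGroup (Fin N) ℂ)) {lo hi : Fin P.d → ℤ}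
    (hN : ∀ κ, hi κ - lo κ < P.sitesPerDir j) {x : Fin P.d → ℤ} (hx : lo ≤ x) (hx' : x ≤ hi) (Y : Matrix (Fin N) (Fin N) ℂ) :
    ((T4AxialGaugeSmallField.axialGauge U lo hi (T4AxialGaugeSmallField.castSite x) : Matrix.specialUnitaryGroup (Fin N) ℂ) : Matrix (Fin N) (Fin N) ℂ) * Y *
        star ((T4AxialGaugeSmallField.axialGauge U lo hi (T4AxialGaugeSmallField.castSite x) : Matrix.specialUnitaryGroup (Fin N) ℂ) : Matrix (Fin N) (Fin N) ℂ) =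
      B7Eq78Linearization.conjR (B7Prop1Explicit.axialFn (B10Eq27TorusAxialLog.pull (B10Eq27TorusAxialLog.unitsField (B10Eq27TorusAxialLog.toUField U)) 0) lo x) Y := by
  rw [axialGauge_castSite U hN hx hx', conjR_apply, val_axialFn_pull_unitsField_toUField, val_inv_axialFn_pull_unitsField_toUField]

/-! ## §2 The Setup reading is the box reading -/

/-- (B2) **`cfgPull P (toUField U) z μ = unitsField (toUField U) ⟨castSite z, μ⟩`** (✓`cfgPull_apply` + `transl 0 z = castSite z`).
[cite: Balaban1985RegularSpaces, (1.3) p.77; Balaban1985Averaging, (19) p.21] -/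
theorem cfgPull_toUField_apply {P : Params} {N : ℕ} (U : GaugeField P 0 (Matrix.specialUnitaryGroup (Fin N) ℂ)) (z : Fin P.d → ℤ) (μ : Fin P.d) :
    B8Thm2SetupTorus.cfgPull P (B10Eq27TorusAxialLog.toUField U) z μ =
      B10Eq27TorusAxialLog.unitsField (B10Eq27TorusAxialLog.toUField U) ⟨T4AxialGaugeSmallField.castSite z, μ⟩ := by
  rw [B8Thm2SetupTorus.cfgPull_apply, transl_zero_eq_castSite]

/-! ## §3 The composed door: the rows' two-point `hOSC` left side in the letter's vocabulary -/

/-- (B3) **THE ROWS' TWO-POINT OSCILLATION IS THE LETTER's**: for any matrix field `F` on `ℤᵈ` and box points `x, x′`,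
`‖h_x·F x·h_x⋆ − h_{x′}·F x′·h_{x′}⋆‖ = ‖conjR (axialFn V♯ lo x) (F x) − conjR (axialFn V♯ lo x′) (F x′)‖`, `h_z = ↑(axialGauge U lo hi (castSite z))`,
`V♯ = (unitsField (toUField U))♯₀` — so px13 g29's `norm_conjR_axialFn_sub_conjR_axialFn_le` closes the rows' `hOSC` at the Thm-2 representative.
[cite: Balaban1985Averaging, (8)-(9) pp.18-19; Balaban1985RegularSpaces, (1.36) p.82] -/
theorem norm_sandwich_sub_sandwich_eq [NeZero N] (U : GaugeField P j (Matrix.specialUnitaryGroup (Fin N) ℂ)) {lo hi : Fin P.d → ℤ}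
    (hN : ∀ κ, hi κ - lo κ < P.sitesPerDir j) {x x' : Fin P.d → ℤ} (hx : lo ≤ x) (hxh : x ≤ hi) (hx' : lo ≤ x') (hxh' : x' ≤ hi)
    (F : (Fin P.d → ℤ) → Matrix (Fin N) (Fin N) ℂ) :
    ‖((T4AxialGaugeSmallField.axialGauge U lo hi (T4AxialGaugeSmallField.castSite x) : Matrix.specialUnitaryGroup (Fin N) ℂ) : Matrix (Fin N) (Fin N) ℂ) * F x *
          star ((T4AxialGaugeSmallField.axialGauge U lo hi (T4AxialGaugeSmallField.castSite x) : Matrix.specialUnitaryGroup (Fin N) ℂ) : Matrix (Fin N) (Fin N) ℂ) -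
        ((T4AxialGaugeSmallField.axialGauge U lo hi (T4AxialGaugeSmallField.castSite x') : Matrix.specialUnitaryGroup (Fin N) ℂ) : Matrix (Fin N) (Fin N) ℂ) * F x' *
          star ((T4AxialGaugeSmallField.axialGauge U lo hi (T4AxialGaugeSmallField.castSite x') : Matrix.specialUnitaryGroup (Fin N) ℂ) : Matrix (Fin N) (Fin N) ℂ)‖ =
      ‖B7Eq78Linearization.conjR (B7Prop1Explicit.axialFn (B10Eq27TorusAxialLog.pull (B10Eq27TorusAxialLog.unitsField (B10Eq27TorusAxialLog.toUField U)) 0) lo x) (F x) -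
        B7Eq78Linearization.conjR (B7Prop1Explicit.axialFn (B10Eq27TorusAxialLog.pull (B10Eq27TorusAxialLog.unitsField (B10Eq27TorusAxialLog.toUField U)) 0) lo x') (F x')‖ := by
  rw [coe_axialGauge_mul_mul_star U hN hx hxh, coe_axialGauge_mul_mul_star U hN hx' hxh']

end Summit.QuantumFields.YangMills.Theorems.FluctuationComparisonRegPrIntLS2BetaCovariantOscillationTorusComb

end
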